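import Literature.NumberTheory.ComplexMultiplication.CMTypeRankEvaluationCriterion
import Literature.NumberTheory.ComplexMultiplication.CMTypeRankStabilizerClosure
import Literature.NumberTheory.ComplexMultiplication.CMTypeRankTypeConjugation
import HarnessLib

/-!
# ORBIT BALANCE (pairs): vanishing sums of translates of the type vector along the subgroup generated by the two type
# stabilisers force `Hg(A₀ × A₁) = Hg(A₀) × Hg(A₁)`

COR-CM (cell `pub-hodgecm2`, binder seat `b16` gen 62, count-neutral claim ORBIT BALANCE, file O1 — abstract `G`-set
level; theorems only, no definition, no named fact, no `sorry`).  NEW as stated, hence under `Summits/`.  HONEST FRAMING: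
unconditional finite-dimensional linear algebra over `ℚ` about the rank of families of CM types (on Mumford–Tate groups:
`Hg(∏_i A_i) = ∏_i Hg(A_i)`); `HC_CM` is neither used nor asserted.

SETTING (as in this seat's `IrreducibleOddWeights*` files and `Literature/…/CMTypeRankEvaluationCriterion`): a group `G`
acts on finite slots `E_i`; `Φ_i ⊆ E_i`; `u_i = u_1(Φ_i) = 2·𝟙_{Φ_i} − 1` the type vector; `U(Φ_i) = antiSpan G (Φ i)`
the span of its translates `γ·u_i = (x ↦ u_i(γ⁻¹x))`; `Σ = sigmaType Φ`; additivity `U(Σ) = ⊕_i U(Φ_i)` is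
`Hg(∏_i A_i) = ∏_i Hg(A_i)` for CM abelian varieties `A_i` of types `Φ_i`.  The non-abelian Kubota criterion
(`forall_map_slotExt_le_of_forall_irreducible`): additivity holds iff in every irreducible representation `(π, V)` the
evaluation vectors `T_i(u_i)` of equivariant `T_i : ℚ^{E_i} → V` are linearly independent.

THE MECHANISM.  For a PAIR `{i₀, i₁}` a colliding evaluation vector `v = T_{i₀}(u_{i₀}) = −T_{i₁}(u_{i₁})` is FIXED by
the stabiliser `S_{i₀}` of the type `Φ_{i₀}` (it fixes `u_{i₀}`) and by `S_{i₁}`, hence by `Γ = ⟨S_{i₀} ∪ S_{i₁}⟩` (this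
seat's gen 41, `Literature/…/CMTypeRankStabilizerClosure`, used there with ONE element of `Γ` acting as `ρ`).  If some
non-empty family of translates of `u_{i₀}` by elements of `Γ` SUMS TO ZERO, `Σ_k γ_k·u_{i₀} = 0`, then
`(n+1)·v = Σ_k π(γ_k) v = T_{i₀}(Σ_k γ_k·u_{i₀}) = 0`: no collision, the pair is additive.  Two suppliers of vanishing
sums (§0): an element `γ ∈ Γ` acting on the slot as the conjugation `ρ` (`u + γ·u = 0`, the two-term case = gen 41), and
VANISHING ORBIT SUMS `Σ_{y ∈ Hx} u(y) = 0` of a subgroup `H ≤ Γ` («`Φ_{i₀}` is EQUIDISTRIBUTED along the `H`-orbits»: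
every orbit meets `Φ_{i₀}` in exactly half of its points), through the finite image of `H` in the permutations of the slot.

* §0 **`exists_translates_sum_eq_zero_of_orbit_sums_eq_zero`** (orbit balance ⟹ a vanishing sum of translates, for any
  `u : X → ℚ` on a finite `G`-set), `exists_translates_sum_eq_zero_of_smul_eq_rho` (a `ρ`-element ⟹ the two-term sum).
* §1 **`forall_map_slotExt_le_of_translates_sum_eq_zero`** — `U(Φ_{i₀}, Φ_{i₁}) = U(Φ_{i₀}) ⊕ U(Φ_{i₁})` from a
  vanishing sum of `⟨S_{i₀} ∪ S_{i₁}⟩`-translates of `u_{i₀}`; **`forall_map_slotExt_le_of_orbit_sums_eq_zero`** (orbit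
  form, any `H ≤ ⟨S_{i₀} ∪ S_{i₁}⟩`); rank forms `typeRank_sigmaType_add_card_eq_of_orbit_sums_eq_zero`
  (`rank(Φ₀,Φ₁) + 2 = rank Φ₀ + rank Φ₁ + 1`), `typeRank_sigmaType_eq_iff_forall_of_orbit_sums_eq_zero` (the pair is
  nondegenerate iff both members are); gen 41's `forall_map_slotExt_le_of_smul_eq_rho_of_mem_closure` is the case of
  the two-term sum supplied by `exists_translates_sum_eq_zero_of_smul_eq_rho`.
  For `G = Aut(ℂ)`: `S_k = Aut(ℂ/K_k*)` (`K_k*` the reflex field), so `H` may be `Aut(ℂ/F)` for any number field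
  `F ⊇ K₀* ∩ K₁*` — the REFLEX LEVEL; the new cases are pairs whose reflex fields meet in a CM field over (a Galois
  subfield of) which one type is equidistributed (file O3).  Families: file O2 (`…OrbitBalanceFamilies`).

## References

* [Gordon1999HodgeAVSurvey] B. B. Gordon, *A survey of the Hodge conjecture for abelian varieties*, §3 Theorem (Imai,
  Murty) with proof, 7.5–7.7.
* [Deligne1982HodgeCycles] P. Deligne, *Hodge cycles on abelian varieties*, LNM 900 (1982), I Ex. 3.7 (c).
* [Serre1977] J.-P. Serre, *Linear Representations of Finite Groups*, GTM 42, §2.2 Prop. 4 (Schur).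
* [Shimura1998] G. Shimura, *Abelian Varieties with Complex Multiplication and Modular Functions*, §8.3 (reflex field =
  fixed field of the stabiliser of the type), §32.10.
* [MoonenZarhin1999LowDim] B. Moonen, Yu. Zarhin, *Hodge classes on abelian varieties of low dimension*, Math. Ann.
  315 (1999), §3 (3.1).

Provenance: Literature home (family `hodge`, namespace `Literature.NumberTheory.ComplexMultiplication.OrbitBalance`) of the Summits-side `CorCM/IrreducibleOddWeightsOrbitBalance` (cell `pub-hodgecm2`, COR-CM; all its imports are `Literature/` and Mathlib), which `Literature/` may not import; theorems only, no named fact, no definition. Nothing here bears on `HC_CM`. Lane `lit-hodgefound` (Layer A3: CM types, their Kubota ranks and Galois combinatorics), seat p20.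
-/

set_option autoImplicit false

noncomputable section

open scoped BigOperators

universe u u' v w

namespace Literature.NumberTheory.ComplexMultiplication.OrbitBalance

namespace IrrOdd

open Literature.NumberTheory.ComplexMultiplication

variable {G : Type w} [Group G]

/-- The evaluation space `Ev[G, π, w] = {T w : T equivariant}` (local notation, no definition). -/
local notation3 (prettyPrint := false) "Ev[" G' ", " π ", " w "]" =>
  Submodule.span ℚ {v | ∃ T : (_ → ℚ) →ₗ[ℚ] _,
    (∀ (g : G') (f : _ → ℚ), T (fun x => f (g⁻¹ • x)) = π g (T f)) ∧ T w = v}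

/-! ### §0 Currency: vanishing sums of translates, from orbit balance and from a `ρ`-element -/

section Currency

variable {X : Type v} [MulAction G X]

/-- **ORBIT BALANCE ⟹ A VANISHING SUM OF TRANSLATES.**  If `u : X → ℚ` has zero sum over every orbit of the subgroup
`H ≤ G` on the finite `G`-set `X`, then some non-empty finite family `γ_0, …, γ_n ∈ H` has `Σ_k u(γ_k⁻¹ x) = 0` for
EVERY `x` (take lifts of the finite image of `H` in the permutations of `X`: `Σ_{δ ∈ H̄} u(δ x) = |Stab_{H̄}(x)| · Σ_{y ∈ Hx} u(y)`).
[cite: Serre1977, §2.2 Prop. 4] -/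
theorem exists_translates_sum_eq_zero_of_orbit_sums_eq_zero [Fintype X] (H : Subgroup G) (u : X → ℚ)
    (hbal : ∀ x : X, ∃ s : Finset X, (∀ y, y ∈ s ↔ y ∈ MulAction.orbit H x) ∧ ∑ y ∈ s, u y = 0) :
    ∃ (n : ℕ) (γ : Fin (n + 1) → G), (∀ k, γ k ∈ H) ∧ ∀ x : X, ∑ k, u ((γ k)⁻¹ • x) = 0 := by
  classical
  -- the finite image `Γ` of `H` in `Perm X`
  let φ : G →* Equiv.Perm X := MulAction.toPermHom G X
  let Γ : Subgroup (Equiv.Perm X) := H.map φ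
  haveI : Finite Γ := Finite.of_injective (fun δ : Γ => (δ : Equiv.Perm X)) Subtype.val_injective
  letI : Fintype Γ := Fintype.ofFinite Γ
  have hφ : ∀ (g : G) (x : X), φ g x = g • x := fun g x => rfl
  -- lifts of the elements of `Γ` to `H`
  have hlift : ∀ δ : Γ, ∃ γ : G, γ ∈ H ∧ φ γ = (δ : Equiv.Perm X) := fun δ => by
    obtain ⟨γ, hγ, hγδ⟩ := Subgroup.mem_map.1 δ.2
    exact ⟨γ, hγ, hγδ⟩
  choose lift hliftH hliftφ using hlift
  -- index `Γ` by `Fin (n + 1)`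
  have hcard : Fintype.card Γ ≠ 0 := Fintype.card_ne_zero
  obtain ⟨n, hn⟩ := Nat.exists_eq_succ_of_ne_zero hcard
  let e : Fin (n + 1) ≃ Γ := (Fintype.equivFinOfCardEq hn).symm
  refine ⟨n, fun k => lift (e k), fun k => hliftH (e k), fun x => ?_⟩
  -- `Σ_k u((γ_k)⁻¹ x) = Σ_{δ ∈ Γ} u(δ⁻¹ x) = Σ_{δ ∈ Γ} u(δ x)`
  have h1' : ∑ k, u ((lift (e k))⁻¹ • x) = ∑ δ : Γ, u (((δ : Equiv.Perm X))⁻¹ x) := by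
    have : ∀ k, u ((lift (e k))⁻¹ • x) = (fun δ : Γ => u (((δ : Equiv.Perm X))⁻¹ x)) (e k) := by
      intro k
      change u ((lift (e k))⁻¹ • x) = u (((e k : Γ) : Equiv.Perm X)⁻¹ x)
      rw [← hliftφ (e k), ← map_inv, hφ]
    simp_rw [this]
    exact e.sum_comp (fun δ : Γ => u (((δ : Equiv.Perm X))⁻¹ x))
  have h2 : ∑ δ : Γ, u (((δ : Equiv.Perm X))⁻¹ x) = ∑ δ : Γ, u ((δ : Equiv.Perm X) x) :=
    Fintype.sum_equiv (Equiv.inv Γ) _ _ fun δ => by simp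
  rw [h1', h2]
  -- group the sum over `Γ` along the fibres of `δ ↦ δ x`
  obtain ⟨s, hs, hs0⟩ := hbal x
  have himg : (Finset.univ : Finset Γ).image (fun δ : Γ => (δ : Equiv.Perm X) x) = s := by
    ext y
    rw [Finset.mem_image, hs, MulAction.mem_orbit_iff]
    constructor
    · rintro ⟨δ, -, rfl⟩
      exact ⟨⟨lift δ, hliftH δ⟩, by
        change (lift δ) • x = (δ : Equiv.Perm X) x
        rw [← hφ, hliftφ]⟩
    · rintro ⟨⟨γ, hγ⟩, rfl⟩
      exact ⟨⟨φ γ, Subgroup.mem_map.2 ⟨γ, hγ, rfl⟩⟩, Finset.mem_univ _, by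
        change (φ γ) x = (⟨γ, hγ⟩ : H) • x
        rw [hφ]; rfl⟩
  -- all fibres over the orbit have the cardinality of the stabiliser
  have hfib : ∀ y ∈ (Finset.univ : Finset Γ).image (fun δ : Γ => (δ : Equiv.Perm X) x),
      (Finset.univ.filter fun δ : Γ => (δ : Equiv.Perm X) x = y).card =
        (Finset.univ.filter fun δ : Γ => (δ : Equiv.Perm X) x = x).card := by
    intro y hy
    obtain ⟨δ₀, -, rfl⟩ := Finset.mem_image.1 hy
    refine (Finset.card_bij' (fun δ _ => δ₀⁻¹ * δ) (fun δ _ => δ₀ * δ) (fun δ hδ => ?_) (fun δ hδ => ?_)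
      (fun δ _ => by group) (fun δ _ => by group))
    · rw [Finset.mem_filter] at hδ ⊢
      refine ⟨Finset.mem_univ _, ?_⟩
      change ((δ₀ : Equiv.Perm X)⁻¹ * (δ : Equiv.Perm X)) x = x
      rw [Equiv.Perm.mul_apply, hδ.2, Equiv.Perm.coe_inv, Equiv.symm_apply_apply]
    · rw [Finset.mem_filter] at hδ ⊢
      refine ⟨Finset.mem_univ _, ?_⟩
      change ((δ₀ : Equiv.Perm X) * (δ : Equiv.Perm X)) x = (δ₀ : Equiv.Perm X) x
      rw [Equiv.Perm.mul_apply, hδ.2]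
  rw [Finset.sum_comp u fun δ : Γ => (δ : Equiv.Perm X) x]
  rw [Finset.sum_congr rfl fun y hy => by rw [hfib y hy], ← Finset.smul_sum, himg, hs0, smul_zero]

/-- **A `ρ`-ELEMENT ⟹ THE TWO-TERM VANISHING SUM.**  If `g ∈ H` acts on the slot as the conjugation `ρ` of the CM type `Φ`,
then `u_1(Φ) + g·u_1(Φ) = 0` (`u_1(Φ)(g⁻¹x) = u_1(Φ)(ρx) = −u_1(Φ)(x)`). [cite: Shimura1998, §32.10 (proof)] -/
theorem exists_translates_sum_eq_zero_of_smul_eq_rho {ρ : G} {Φ : Set X} (h : IsCMTypeWith ρ Φ) {H : Subgroup G}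
    {g : G} (hgH : g ∈ H) (hg : ∀ x : X, g • x = ρ • x) :
    ∃ (n : ℕ) (γ : Fin (n + 1) → G), (∀ k, γ k ∈ H) ∧ ∀ x : X, ∑ k, antiVec Φ (1 : G) ((γ k)⁻¹ • x) = 0 := by
  refine ⟨1, ![1, g], fun k => ?_, fun x => ?_⟩
  · fin_cases k
    · exact H.one_mem
    · exact hgH
  · rw [Fin.sum_univ_two]
    change antiVec Φ (1 : G) ((1 : G)⁻¹ • x) + antiVec Φ (1 : G) (g⁻¹ • x) = 0
    rw [inv_one, one_smul, congrFun (antiVec_one_comp_inv_smul_of_smul_eq_rho h hg) x, Pi.neg_apply, add_neg_cancel]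

end Currency

variable {I : Type u} {E : I → Type v} [∀ i, MulAction G (E i)] [Fintype I] [DecidableEq I] [∀ i, Fintype (E i)]

/-! ### §1 Pairs, type level: translates along the subgroup generated by the two type stabilisers -/

/-- **PAIR ADDITIVITY FROM A VANISHING SUM OF `⟨S_{i₀} ∪ S_{i₁}⟩`-TRANSLATES.**  Two-slot family `{i₀, i₁}`, `S_k` the
stabiliser of the type `Φ_{i_k}`.  If some non-empty family `γ_0, …, γ_n` in the subgroup generated by `S_{i₀} ∪ S_{i₁}`
has `Σ_k γ_k·u_1(Φ_{i₀}) = 0`, then `ext_i U(Φ_i) ≤ U(Σ)` for both slots: `U(Φ_{i₀}, Φ_{i₁}) = U(Φ_{i₀}) ⊕ U(Φ_{i₁})`,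
`Hg(A₀ × A₁) = Hg(A₀) × Hg(A₁)`.  (In every irreducible representation `v = T_{i₀}(u_{i₀}) = −T_{i₁}(u_{i₁})` is fixed by
the generated subgroup, so `(n+1)·v = T_{i₀}(Σ_k γ_k·u_{i₀}) = 0`.)  Gen 41's `…_of_smul_eq_rho_of_mem_closure` is the
two-term case `u + γ·u = 0`. [cite: Gordon1999HodgeAVSurvey, §3 Theorem (proof)] [cite: Deligne1982HodgeCycles, I Ex. 3.7 (c)] -/
theorem forall_map_slotExt_le_of_translates_sum_eq_zero {Φ : ∀ i, Set (E i)} {i₀ i₁ : I}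
    (hI : ∀ j, j = i₀ ∨ j = i₁) (h01 : i₀ ≠ i₁)
    (hcomb : ∃ (n : ℕ) (γ : Fin (n + 1) → G),
      (∀ k, γ k ∈ Subgroup.closure
        ({s : G | ∀ x : E i₀, s • x ∈ Φ i₀ ↔ x ∈ Φ i₀} ∪ {s : G | ∀ y : E i₁, s • y ∈ Φ i₁ ↔ y ∈ Φ i₁})) ∧
      ∀ x : E i₀, ∑ k, antiVec (Φ i₀) (1 : G) ((γ k)⁻¹ • x) = 0) :
    ∀ i, (antiSpan G (Φ i)).map (slotExt i) ≤ antiSpan G (sigmaType Φ) := by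
  refine forall_map_slotExt_le_of_forall_irreducible Φ fun V _ _ _ π _ T hT hsum => ?_
  obtain ⟨n, γ, hγ, hγ0⟩ := hcomb
  -- `v := T_{i₀}(u₀) = −T_{i₁}(u₁)`
  have hsum2 : T i₀ (antiVec (Φ i₀) (1 : G)) + T i₁ (antiVec (Φ i₁) (1 : G)) = 0 := by
    rw [Fintype.sum_eq_add i₀ i₁ h01 (fun j hj => ?_)] at hsum
    · exact hsum
    · rcases hI j with rfl | rfl
      · exact absurd rfl hj.1
      · exact absurd rfl hj.2
  set v := T i₀ (antiVec (Φ i₀) (1 : G)) with hv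
  -- `v` is fixed by the generated subgroup
  have hfix : ∀ s ∈ Subgroup.closure
      ({s : G | ∀ x : E i₀, s • x ∈ Φ i₀ ↔ x ∈ Φ i₀} ∪ {s : G | ∀ y : E i₁, s • y ∈ Φ i₁ ↔ y ∈ Φ i₁}),
      π s v = v := by
    intro s hs
    induction hs using Subgroup.closure_induction with
    | mem s hs =>
      rcases hs with hs | hs
      · rw [hv, ← hT i₀ s, antiVec_one_comp_inv_smul_of_stabilizes hs]
      · have hv' : v = -T i₁ (antiVec (Φ i₁) (1 : G)) := eq_neg_of_add_eq_zero_left hsum2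
        rw [hv', map_neg, ← hT i₁ s, antiVec_one_comp_inv_smul_of_stabilizes hs]
    | one => rw [map_one, Module.End.one_apply]
    | mul a b _ _ ha hb => rw [map_mul, Module.End.mul_apply, hb, ha]
    | inv a _ ha =>
      have := congrArg (π a⁻¹) ha
      rw [← Module.End.mul_apply, ← map_mul, inv_mul_cancel, map_one, Module.End.one_apply] at this
      exact this.symm
  -- `(n+1) • v = T_{i₀}(Σ_k γ_k·u₀) = 0`
  have hnv : ((n + 1 : ℕ) : ℚ) • v = 0 := by
    have h1 : ∑ k : Fin (n + 1), π (γ k) v = ((n + 1 : ℕ) : ℚ) • v := by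
      rw [Finset.sum_congr rfl fun k _ => hfix (γ k) (hγ k), Finset.sum_const, Finset.card_univ, Fintype.card_fin,
        Nat.cast_smul_eq_nsmul]
    have h2 : ∑ k : Fin (n + 1), π (γ k) v = T i₀ (fun x => ∑ k : Fin (n + 1), antiVec (Φ i₀) (1 : G) ((γ k)⁻¹ • x)) := by
      rw [hv]
      have : (fun x => ∑ k : Fin (n + 1), antiVec (Φ i₀) (1 : G) ((γ k)⁻¹ • x)) =
          ∑ k : Fin (n + 1), fun x => antiVec (Φ i₀) (1 : G) ((γ k)⁻¹ • x) := by
        funext x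
        simp only [Finset.sum_apply]
      rw [this, map_sum]
      exact Finset.sum_congr rfl fun k _ => (hT i₀ (γ k) (antiVec (Φ i₀) (1 : G))).symm
    have h3 : (fun x => ∑ k : Fin (n + 1), antiVec (Φ i₀) (1 : G) ((γ k)⁻¹ • x)) = 0 := by
      funext x
      exact hγ0 x
    rw [← h1, h2, h3, map_zero]
  have hv0 : v = 0 := by
    rcases smul_eq_zero.1 hnv with h | h
    · exact absurd h (by positivity)
    · exact h
  have hv1 : T i₁ (antiVec (Φ i₁) (1 : G)) = 0 := by
    rw [hv0, zero_add] at hsum2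
    exact hsum2
  intro i
  rcases hI i with rfl | rfl
  · exact hv0
  · exact hv1

/-- **PAIR ADDITIVITY FROM ORBIT BALANCE (type level).**  If `Φ_{i₀}` is EQUIDISTRIBUTED along the orbits on `E_{i₀}` of
some subgroup `H ≤ ⟨S_{i₀} ∪ S_{i₁}⟩` — `Σ_{y ∈ Hx} u_1(Φ_{i₀})(y) = 0` for every `x`, i.e. every `H`-orbit meets `Φ_{i₀}` in
exactly half of its points — then `U(Φ_{i₀}, Φ_{i₁}) = U(Φ_{i₀}) ⊕ U(Φ_{i₁})` (`Hg(A₀ × A₁) = Hg(A₀) × Hg(A₁)`).  For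
`G = Aut(ℂ)`: `S_k = Aut(ℂ/K_k*)` and `H = Aut(ℂ/F)` for any number field `F ⊇ K₀* ∩ K₁*`.
[cite: Gordon1999HodgeAVSurvey, §3 Theorem (proof)] [cite: Shimura1998, §8.3] -/
theorem forall_map_slotExt_le_of_orbit_sums_eq_zero {Φ : ∀ i, Set (E i)} {i₀ i₁ : I} (hI : ∀ j, j = i₀ ∨ j = i₁)
    (h01 : i₀ ≠ i₁) (H : Subgroup G)
    (hH : H ≤ Subgroup.closure
      ({s : G | ∀ x : E i₀, s • x ∈ Φ i₀ ↔ x ∈ Φ i₀} ∪ {s : G | ∀ y : E i₁, s • y ∈ Φ i₁ ↔ y ∈ Φ i₁}))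
    (hbal : ∀ x : E i₀, ∃ s : Finset (E i₀),
      (∀ y, y ∈ s ↔ y ∈ MulAction.orbit H x) ∧ ∑ y ∈ s, antiVec (Φ i₀) (1 : G) y = 0) :
    ∀ i, (antiSpan G (Φ i)).map (slotExt i) ≤ antiSpan G (sigmaType Φ) := by
  obtain ⟨n, γ, hγ, hγ0⟩ := exists_translates_sum_eq_zero_of_orbit_sums_eq_zero H (antiVec (Φ i₀) (1 : G)) hbal
  exact forall_map_slotExt_le_of_translates_sum_eq_zero hI h01 ⟨n, γ, fun k => hH (hγ k), hγ0⟩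

variable [Nonempty I] [∀ i, Nonempty (E i)] in
/-- **Rank form for the pair**: orbit balance along `H ≤ ⟨S_{i₀} ∪ S_{i₁}⟩` ⟹ `rank(Φ₀, Φ₁) + 2 = rank Φ₀ + rank Φ₁ + 1`
(`dim MT(A₀ × A₁) − 1 = (dim MT(A₀) − 1) + (dim MT(A₁) − 1)`). [cite: Gordon1999HodgeAVSurvey, §3 Theorem (1) and 7.7] -/
theorem typeRank_sigmaType_add_card_eq_of_orbit_sums_eq_zero {ρ : G} {Φ : ∀ i, Set (E i)}
    (h : ∀ i, IsCMTypeWith ρ (Φ i)) {i₀ i₁ : I} (hI : ∀ j, j = i₀ ∨ j = i₁) (h01 : i₀ ≠ i₁) (H : Subgroup G)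
    (hH : H ≤ Subgroup.closure
      ({s : G | ∀ x : E i₀, s • x ∈ Φ i₀ ↔ x ∈ Φ i₀} ∪ {s : G | ∀ y : E i₁, s • y ∈ Φ i₁ ↔ y ∈ Φ i₁}))
    (hbal : ∀ x : E i₀, ∃ s : Finset (E i₀),
      (∀ y, y ∈ s ↔ y ∈ MulAction.orbit H x) ∧ ∑ y ∈ s, antiVec (Φ i₀) (1 : G) y = 0) :
    typeRank G (sigmaType Φ) + Fintype.card I = (∑ i, typeRank G (Φ i)) + 1 :=
  typeRank_sigmaType_add_card_eq_of_forall_map_le h (forall_map_slotExt_le_of_orbit_sums_eq_zero hI h01 H hH hbal)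

variable [Nonempty I] [∀ i, Nonempty (E i)] in
/-- **The pair is nondegenerate iff both members are**, under orbit balance along `H ≤ ⟨S_{i₀} ∪ S_{i₁}⟩`.
[cite: Gordon1999HodgeAVSurvey, §3 Theorem (2) and 7.6.1] -/
theorem typeRank_sigmaType_eq_iff_forall_of_orbit_sums_eq_zero {ρ : G} {Φ : ∀ i, Set (E i)}
    (h : ∀ i, IsCMTypeWith ρ (Φ i)) {i₀ i₁ : I} (hI : ∀ j, j = i₀ ∨ j = i₁) (h01 : i₀ ≠ i₁) (H : Subgroup G)
    (hH : H ≤ Subgroup.closure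
      ({s : G | ∀ x : E i₀, s • x ∈ Φ i₀ ↔ x ∈ Φ i₀} ∪ {s : G | ∀ y : E i₁, s • y ∈ Φ i₁ ↔ y ∈ Φ i₁}))
    (hbal : ∀ x : E i₀, ∃ s : Finset (E i₀),
      (∀ y, y ∈ s ↔ y ∈ MulAction.orbit H x) ∧ ∑ y ∈ s, antiVec (Φ i₀) (1 : G) y = 0) :
    typeRank G (sigmaType Φ) = Fintype.card (Σ i, E i) / 2 + 1 ↔
      ∀ i, typeRank G (Φ i) = Fintype.card (E i) / 2 + 1 :=
  typeRank_sigmaType_eq_iff_forall_of_forall_map_le h (forall_map_slotExt_le_of_orbit_sums_eq_zero hI h01 H hH hbal)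

end IrrOdd

end Literature.NumberTheory.ComplexMultiplication.OrbitBalance

end
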